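import Summits.AtomisticToContinuum.BoseEinsteinCondensation.Theorems.BECCutLineWeakDisorderWitnessTransferCoreEntry
import HarnessLib

/-!
# Route BECCutLineWeakDisorder — `WitnessTransfer`, hard-sphere vanishing III:
# `e^{-TH}1 → 0` uniformly near the hard core (stub `stub_vanish_hardSphere`)

Support file (does not close the item) for item stmt-AtomisticToContinuum-14978
(`Summit.AtomisticToContinuum.BoseEinsteinCondensation.Theses.BECCutLineWeakDisorder`, decl
`WitnessTransfer`), closing the registered stub `stub_vanish_hardSphere` of line `Sketch`: the
hard-sphere case of the vanishing input (E2) `stub_vanish`. For a pair potential `v` with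
`v = ⊤` on `[0, a)` whose hard set `hardVec v` lies in the closed ball of radius `a`, for every
`T > 0` and `η > 0` there is `κ > 0` such that `(e^{-TH}1)(X) ≤ η` as soon as some relative position
`xᵢ - xⱼ` is within `κ` of the hard set. Proof: then `|xᵢ - xⱼ| < a + κ`; if `|xᵢ - xⱼ| < a` the
functional vanishes (`fkSemigroup_eq_zero_of_dist_lt`); otherwise the union bound
`fkSemigroup_le_of_near_core` with the explicit parameters
`e = η ∧ 1`, `θ = (a e⁵/30720) ∧ (60T/(ae))`, `c'² = aθ/12`, `τ = aθe/120`, `κ = θ/2 ∧ a`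
gives `(e^{-TH}1)(X) ≤ e/2 + 6 · e/12 = e ≤ η` — the regularity of the hard sphere for the pair
Brownian motion, uniformly in the starting point (Chung–Zhao (1995), §1.4, Thm 3.17 (iv)).

## References

* K. L. Chung, Z. Zhao, *From Brownian Motion to Schrödinger's Equation* (1995), §1.4, Thm 3.17.
  [ChungZhao1995]
-/

noncomputable section

open MeasureTheory ProbabilityTheory Filter Set Metric
open scoped ENNReal NNReal Topology

namespace Summit.AtomisticToContinuum.BoseEinsteinCondensation.Theorems.CutLineWitness

open Literature.MathematicalPhysics.QuantumManyBody.BoseGas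
open Literature.Probability.Process

/-! ### Arithmetic of the parameter choice -/

/-- The small-ball term: if `256 θ² ≤ e⁴ τ` with `0 < e ≤ 1`, `0 < θ`, `0 < τ`, then `θ ≤ √τ` and
`2 √(θ/√τ) ≤ e/2`. [folklore] -/
theorem hardSphere_smallBall_term_le {θ τ e : ℝ} (hθ : 0 < θ) (hτ : 0 < τ) (he : 0 < e)
    (he1 : e ≤ 1) (h : 256 * θ ^ 2 ≤ e ^ 4 * τ) :
    θ ≤ Real.sqrt τ ∧ 2 * Real.sqrt (θ / Real.sqrt τ) ≤ e / 2 := by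
  have hsq : 0 < Real.sqrt τ := Real.sqrt_pos.2 hτ
  have he4 : e ^ 4 ≤ 1 := pow_le_one₀ he.le he1
  constructor
  · refine (Real.le_sqrt hθ.le hτ.le).2 ?_
    nlinarith
  · have h16 : 16 * θ ≤ e ^ 2 * Real.sqrt τ := by
      have h1 : 16 * θ ≤ Real.sqrt (e ^ 4 * τ) :=
        (Real.le_sqrt (by positivity) (by positivity)).2 (by nlinarith)
      rwa [Real.sqrt_mul (by positivity), show e ^ 4 = (e ^ 2) ^ 2 by ring,
        Real.sqrt_sq (by positivity)] at h1
    have hdiv : θ / Real.sqrt τ ≤ (e / 4) ^ 2 := by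
      rw [div_le_iff₀ hsq]
      nlinarith
    calc 2 * Real.sqrt (θ / Real.sqrt τ) ≤ 2 * Real.sqrt ((e / 4) ^ 2) := by
          gcongr
      _ = e / 2 := by
          rw [Real.sqrt_sq (by positivity)]
          ring

/-- The running-maximum term: with `τ = q e/10`, `0 < q`, `0 < e ≤ 1`: `τ < q` and
`2τ²/(q - τ)² ≤ e/12`. [folklore] -/
theorem hardSphere_sup_term_le {q τ e : ℝ} (hq : 0 < q) (he : 0 < e) (he1 : e ≤ 1)
    (hτ : τ = q * e / 10) :
    τ < q ∧ 2 * τ ^ 2 / (q - τ) ^ 2 ≤ e / 12 := by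
  subst hτ
  have hlt : q * e / 10 < q := by nlinarith
  refine ⟨hlt, ?_⟩
  rw [div_le_iff₀ (by nlinarith : (0 : ℝ) < (q - q * e / 10) ^ 2)]
  have hb : 0 ≤ (1 - e / 10) ^ 2 / 12 - e / 50 := by nlinarith
  have hprod : 0 ≤ q * q * e * ((1 - e / 10) ^ 2 / 12 - e / 50) := by positivity
  nlinarith

/-- The geometric constraint: for `a ≤ r < a + κ` with `κ ≤ θ/2`, `κ ≤ a` (`a, θ > 0`),
`r² - 4rθ + 2aθ ≤ a²`. [folklore] -/
theorem hardSphere_geom_le {a θ κ r : ℝ} (ha : 0 < a) (hθ : 0 < θ) (har : a ≤ r) (hrκ : r < a + κ)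
    (hκθ : κ ≤ θ / 2) (hκa : κ ≤ a) :
    r ^ 2 - 4 * r * θ + 2 * a * θ ≤ a ^ 2 := by
  have hε0 : 0 ≤ r - a := sub_nonneg.2 har
  have hεκ : r - a ≤ κ := by linarith
  have h1 : a * (r - a) ≤ a * (θ / 2) := mul_le_mul_of_nonneg_left (hεκ.trans hκθ) ha.le
  have h2 : (r - a) * (r - a) ≤ (r - a) * a := mul_le_mul_of_nonneg_left (hεκ.trans hκa) hε0
  have h3 : 0 ≤ (r - a) * θ := mul_nonneg hε0 hθ.le
  nlinarith

/-! ### The stub -/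

/-- **(E2) for hard spheres: `e^{-TH}1 → 0` uniformly near the hard core.** Let the pair potential
`v` be `⊤` on `[0, a)` (`a > 0`) with hard set `hardVec v ⊆ B̄(0, a)`. For `T > 0` and `η > 0`
there is `κ > 0` such that for every configuration `X` with some relative position `xᵢ - xⱼ`
(`i ≠ j`) within `κ` of the hard set, `(e^{-TH}1)(X) ≤ η`. Indeed `|xᵢ - xⱼ| < a + κ`; inside the
open core the Feynman–Kac functional vanishes (`fkSemigroup_eq_zero_of_dist_lt`), and from the
shell `a ≤ |xᵢ - xⱼ| < a + κ` the pair Brownian motion enters the open core before time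
`τ < T` except on an event of probability `≤ 2√(θ/√τ) + 6 · 2τ²/(c'² - τ)² ≤ η`
(`fkSemigroup_le_of_near_core` with `e = η ∧ 1`, `θ = (ae⁵/30720) ∧ (60T/(ae))`, `c'² = aθ/12`,
`τ = aθe/120`, `κ = θ/2 ∧ a`): the regularity of the hard sphere for Brownian motion, uniform in
the starting point. [cite: ChungZhao1995, Thm 3.17] -/
theorem stub_vanish_hardSphere {N : ℕ} {v : ℝ → ℝ≥0∞} {a : ℝ} (ha : 0 < a)
    (hcore : ∀ r : ℝ, 0 ≤ r → r < a → v r = ⊤) (hHa : hardVec v ⊆ Metric.closedBall (0 : Space) a)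
    (L : ℝ) {T : ℝ} (hT : 0 < T) {η : ℝ} (hη : 0 < η) :
    ∃ κ : ℝ, 0 < κ ∧ ∀ X : Config N,
      (∃ i j : Fin N, i ≠ j ∧ ∃ z ∈ hardVec v, dist (X i - X j) z < κ) →
        fkSemigroup v L T (fun _ => (1 : ℝ≥0∞)) X ≤ ENNReal.ofReal η := by
  -- the parameters
  set e : ℝ := min η 1 with he_def
  have he : 0 < e := lt_min hη one_pos
  have he1 : e ≤ 1 := min_le_right _ _
  have heη : e ≤ η := min_le_left _ _
  set θ : ℝ := min (a * e ^ 5 / 30720) (60 * T / (a * e)) with hθ_def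
  have hθ : 0 < θ := lt_min (by positivity) (by positivity)
  have hθ1 : θ ≤ a * e ^ 5 / 30720 := min_le_left _ _
  have hθ2 : θ ≤ 60 * T / (a * e) := min_le_right _ _
  set q : ℝ := a * θ / 12 with hq_def
  have hq : 0 < q := by positivity
  set c' : ℝ := Real.sqrt q with hc'_def
  have hc' : 0 < c' := Real.sqrt_pos.2 hq
  have hc'2 : c' ^ 2 = q := Real.sq_sqrt hq.le
  have hτ0 : 0 < a * θ * e / 120 := by positivity
  set τ : ℝ≥0 := ⟨a * θ * e / 120, hτ0.le⟩ with hτ_def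
  have hτcoe : (τ : ℝ) = a * θ * e / 120 := rfl
  have hτ : 0 < τ := NNReal.coe_pos.1 (by rw [hτcoe]; exact hτ0)
  have hτq : (τ : ℝ) = q * e / 10 := by
    rw [hτcoe, hq_def]
    ring
  -- the three estimates on the parameters
  have hτT : (τ : ℝ) < T := by
    rw [hτcoe]
    have h1 : θ * (a * e) ≤ 60 * T := (le_div_iff₀ (by positivity)).1 hθ2
    nlinarith
  have h256 : 256 * θ ^ 2 ≤ e ^ 4 * τ := by
    rw [hτcoe]
    nlinarith [mul_le_mul_of_nonneg_left hθ1 (by positivity : (0 : ℝ) ≤ 256 * θ)]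
  obtain ⟨hθτ, hball⟩ := hardSphere_smallBall_term_le hθ (by rw [hτcoe]; exact hτ0) he he1 h256
  obtain ⟨hτc, hsup⟩ := hardSphere_sup_term_le hq he he1 hτq
  rw [← hc'2] at hτc hsup
  -- the margin
  set κ : ℝ := min (θ / 2) a with hκ_def
  refine ⟨κ, lt_min (by positivity) ha, fun X hX => ?_⟩
  obtain ⟨i, j, hij, z, hz, hdz⟩ := hX
  have hza : dist z 0 ≤ a := by
    have h := hHa hz
    rwa [mem_closedBall] at h
  have hyκ : ‖X i - X j‖ < a + κ := by
    calc ‖X i - X j‖ = dist (X i - X j) 0 := (dist_zero_right _).symm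
      _ ≤ dist (X i - X j) z + dist z 0 := dist_triangle _ _ _
      _ < κ + a := add_lt_add_of_lt_of_le hdz hza
      _ = a + κ := add_comm _ _
  by_cases hA : dist (X i) (X j) < a
  · -- the pair starts inside the open core
    rw [fkSemigroup_eq_zero_of_dist_lt hcore L hT _ hij hA]
    exact bot_le
  · -- the pair starts in the shell `a ≤ |xᵢ - xⱼ| < a + κ`
    have hy : a ≤ ‖X i - X j‖ := by
      rw [← dist_eq_norm]
      exact not_lt.1 hA
    have hgeom : ‖X i - X j‖ ^ 2 - 4 * ‖X i - X j‖ * θ + 24 * c' ^ 2 ≤ a ^ 2 := by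
      rw [hc'2, hq_def]
      have h := hardSphere_geom_le ha hθ hy hyκ (min_le_left _ _) (min_le_right _ _)
      linarith
    calc fkSemigroup v L T (fun _ => (1 : ℝ≥0∞)) X
        ≤ ENNReal.ofReal (2 * Real.sqrt (θ / Real.sqrt τ)) +
            6 * ENNReal.ofReal (2 * (τ : ℝ) ^ 2 / (c' ^ 2 - τ) ^ 2) :=
          fkSemigroup_le_of_near_core ha hcore L X hij hθ hc' hτ hτT hθτ hτc hy hgeom
      _ ≤ ENNReal.ofReal (e / 2) + 6 * ENNReal.ofReal (e / 12) :=
          add_le_add (ENNReal.ofReal_le_ofReal hball)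
            (mul_le_mul' le_rfl (ENNReal.ofReal_le_ofReal hsup))
      _ = ENNReal.ofReal e := by
          rw [show (6 : ℝ≥0∞) = ENNReal.ofReal 6 by norm_num,
            ← ENNReal.ofReal_mul (by norm_num : (0 : ℝ) ≤ 6),
            ← ENNReal.ofReal_add (by positivity) (by positivity)]
          congr 1
          ring
      _ ≤ ENNReal.ofReal η := ENNReal.ofReal_le_ofReal heη

end Summit.AtomisticToContinuum.BoseEinsteinCondensation.Theorems.CutLineWitness
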